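import Summits.AnomalousDissipation.AnomalousDissipation.Theorems.SolenoidalFractalHomogenisationLagrangianStepWindowFactsHAssemblyV3
import Summits.AnomalousDissipation.AnomalousDissipation.Theorems.SolenoidalFractalHomogenisationLagrangianStepCellInputsOfBilinear
import Summits.AnomalousDissipation.AnomalousDissipation.Theorems.SolenoidalFractalHomogenisationLagrangianStepTemplateAsymptotics
import Summits.AnomalousDissipation.AnomalousDissipation.Theorems.SolenoidalFractalHomogenisationLagrangianStepTransferAlgebra

/-!
# K1L_D (stmt-AnomalousDissipation-27980), registry stub `stub_cellInputs_transfer` (§9d): the six transfer bounds FROM the bilinear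
# window-error text §9z and the §4c W3-E text — `cellInputs_transfer_of_bilinear_bandKill` (helper; prover ad-k1loc-p3 g8, TAKES #17; lead memo L14, D26-16)

Inputs: (BIL) `hz` = the §9z text (hypothesis `hz` of `cellInputs_of_bilinear`): `|⟪(U − T)x, y⟫| ≤ ηz·N(x)·N(y)` on every grid window;
(W3-E) `hW3E` = the §4c text v31 (as in `windowFactsH_of_inputs₃`): dissipation floor and band kill of the coarse map and its adjoint.
Derivation: STRONG FORM `‖(U − T)x‖ ≤ ηz·N(x)` (test with `y := (U − T)x`, `N ≤ ‖·‖`); (Hi) `‖Q_i(T y)‖ ≤ ε‖y‖` for both high label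
projectors (`hi_of_bandKill` at levels `Lc/2/2, Lc/2` + `hi_tails_le_eps`); (R3)–(R6) by `Transfer.norm_high_transfer_le`, (R6) with `ηz ≤ 1/2`
eventually; (R1)/(R2): `‖Q_i(U(Pu))‖ ≤ ε‖Pu‖ + ηz·N(Pu)`, `N(Pu) ≤ N(u)` (`P` is a Fourier multiplier by an indicator, weights `≥ 0`) and
`N(u)² ≤ 2 q_T(u)` (`floor_meanfree`, zero mode by `fcoeff_zero_apply_eq`, off-ball saturation `off_ball_rate_ge_one`).  Classes
`B := Aᶜ ∩ {|k|² ≤ Lc²}`, `C := Aᶜ ∩ {|k|² > Lc²}`; output constants `(Cz′, σz) = (2Cz² + Cz, σz)`, `θ₀′ = min θ₀ θ₁`.  The conclusion is the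
hypothesis `h9d` of `cellInputs_of_bilinear` VERBATIM.  NOT a proof of §9z or of W3-E; K1L_D open; AD not claimed; rung F-D1.A0.
-/


set_option linter.dupNamespace false

noncomputable section

namespace Summit.AnomalousDissipation.AnomalousDissipation.Theorems.SolenoidalFractalHomogenisation.LagrangianStep

open Literature.Analysis Literature.Analysis.FluidPDE Literature.Analysis.FunctionSpaces
open MeasureTheory Set Filter ContinuousLinearMap UnitAddTorus
open scoped ENNReal NNReal InnerProductSpace Classical
open Literature.Analysis.FluidPDE.LatticeShear
open Summit.AnomalousDissipation.AnomalousDissipation.Theorems.SolenoidalFractalHomogenisation.RealisedQuasiStaticCellLaw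
open Summit.AnomalousDissipation.AnomalousDissipation.Theorems.SolenoidalFractalHomogenisation.LagrangianRenormalisationStep
open Summit.AnomalousDissipation.AnomalousDissipation.Theorems.SolenoidalFractalHomogenisation.PermissibleCarrier (period_pos)
open OneLevelSplit

/-- `N(x)² ≤ ‖x‖²` when the weights are `≤ 1`. [folklore] -/
theorem weightedNormSq_le_norm_sq (S : Finset (Fin 3 → ℤ)) (w : (Fin 3 → ℤ) → ℝ) (hw1 : ∀ k', w k' ≤ 1) (x : V2) :
    ∑ k' ∈ S, w k' * ‖mFourierCoeff (EuclideanSpace.complexify ∘ ⇑x) k'‖ ^ 2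
      + (‖x‖ ^ 2 - ∑ k' ∈ S, ‖mFourierCoeff (EuclideanSpace.complexify ∘ ⇑x) k'‖ ^ 2) ≤ ‖x‖ ^ 2 := by
  have h : ∑ k' ∈ S, w k' * ‖mFourierCoeff (EuclideanSpace.complexify ∘ ⇑x) k'‖ ^ 2
      ≤ ∑ k' ∈ S, ‖mFourierCoeff (EuclideanSpace.complexify ∘ ⇑x) k'‖ ^ 2 :=
    Finset.sum_le_sum fun k' _ => by
      have := hw1 k'; have h0 := sq_nonneg ‖mFourierCoeff (EuclideanSpace.complexify ∘ ⇑x) k'‖; nlinarith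
  linarith

/-- **`N(P u)² ≤ N(u)²` for a label projector `P`** (a Fourier multiplier by the indicator of `A`), weights `≥ 0`. [folklore] -/
theorem weightedNormSq_proj_le (S : Finset (Fin 3 → ℤ)) (w : (Fin 3 → ℤ) → ℝ) (hw0 : ∀ k', 0 ≤ w k')
    {A : Set (Fin 3 → ℤ)} {P : V2 →L[ℝ] V2}
    (hP : ∀ (y : V2) (k' : Fin 3 → ℤ), mFourierCoeff (EuclideanSpace.complexify ∘ ⇑(P y)) k'
      = if k' ∈ A then mFourierCoeff (EuclideanSpace.complexify ∘ ⇑y) k' else 0) (u : V2) :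
    ∑ k' ∈ S, w k' * ‖mFourierCoeff (EuclideanSpace.complexify ∘ ⇑(P u)) k'‖ ^ 2
        + (‖P u‖ ^ 2 - ∑ k' ∈ S, ‖mFourierCoeff (EuclideanSpace.complexify ∘ ⇑(P u)) k'‖ ^ 2)
      ≤ ∑ k' ∈ S, w k' * ‖mFourierCoeff (EuclideanSpace.complexify ∘ ⇑u) k'‖ ^ 2
        + (‖u‖ ^ 2 - ∑ k' ∈ S, ‖mFourierCoeff (EuclideanSpace.complexify ∘ ⇑u) k'‖ ^ 2) := by
  have hle : ∀ k', ‖mFourierCoeff (EuclideanSpace.complexify ∘ ⇑(P u)) k'‖ ^ 2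
      ≤ ‖mFourierCoeff (EuclideanSpace.complexify ∘ ⇑u) k'‖ ^ 2 := fun k' => by
    rw [hP u k']
    split_ifs
    · exact le_rfl
    · rw [norm_zero, sq, zero_mul]; exact sq_nonneg _
  have htail : ∀ x : V2, HasSum (fun k' => if k' ∈ S then (0 : ℝ) else ‖mFourierCoeff (EuclideanSpace.complexify ∘ ⇑x) k'‖ ^ 2)
      (‖x‖ ^ 2 - ∑ k' ∈ S, ‖mFourierCoeff (EuclideanSpace.complexify ∘ ⇑x) k'‖ ^ 2) := by
    intro x
    have h2 : HasSum (fun k' => if k' ∈ S then ‖mFourierCoeff (EuclideanSpace.complexify ∘ ⇑x) k'‖ ^ 2 else (0 : ℝ))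
        (∑ k' ∈ S, if k' ∈ S then ‖mFourierCoeff (EuclideanSpace.complexify ∘ ⇑x) k'‖ ^ 2 else (0 : ℝ)) :=
      hasSum_sum_of_ne_finset_zero (fun k' hk' => if_neg hk')
    have hg : (∑ k' ∈ S, if k' ∈ S then ‖mFourierCoeff (EuclideanSpace.complexify ∘ ⇑x) k'‖ ^ 2 else (0 : ℝ))
        = ∑ k' ∈ S, ‖mFourierCoeff (EuclideanSpace.complexify ∘ ⇑x) k'‖ ^ 2 := Finset.sum_congr rfl (fun k' hk' => if_pos hk')
    rw [hg] at h2
    have e : (fun k' => if k' ∈ S then (0 : ℝ) else ‖mFourierCoeff (EuclideanSpace.complexify ∘ ⇑x) k'‖ ^ 2)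
        = fun k' => ‖mFourierCoeff (EuclideanSpace.complexify ∘ ⇑x) k'‖ ^ 2
          - (if k' ∈ S then ‖mFourierCoeff (EuclideanSpace.complexify ∘ ⇑x) k'‖ ^ 2 else (0 : ℝ)) := by
      funext k'; split_ifs <;> ring
    rw [e]; exact (hasSum_norm_sq_fcoeff x).sub h2
  have hfin : ∑ k' ∈ S, w k' * ‖mFourierCoeff (EuclideanSpace.complexify ∘ ⇑(P u)) k'‖ ^ 2
      ≤ ∑ k' ∈ S, w k' * ‖mFourierCoeff (EuclideanSpace.complexify ∘ ⇑u) k'‖ ^ 2 :=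
    Finset.sum_le_sum fun k' _ => mul_le_mul_of_nonneg_left (hle k') (hw0 k')
  have htl : ‖P u‖ ^ 2 - ∑ k' ∈ S, ‖mFourierCoeff (EuclideanSpace.complexify ∘ ⇑(P u)) k'‖ ^ 2
      ≤ ‖u‖ ^ 2 - ∑ k' ∈ S, ‖mFourierCoeff (EuclideanSpace.complexify ∘ ⇑u) k'‖ ^ 2 :=
    hasSum_le (fun k' => by split_ifs; exacts [le_rfl, hle k']) (htail (P u)) (htail u)
  linarith

/-- **The strong form of (BIL).**  `|⟪(U−T)x, y⟫| ≤ ηz·√N²(x)·√N²(y)` for all `y`, with `N² ≤ ‖·‖²`, gives `‖(U−T)x‖ ≤ ηz·√N²(x)`. [folklore] -/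
theorem norm_sub_le_of_bilinear_strong {U T : V2 →L[ℝ] V2} {x : V2} {ηz : ℝ} (hηz : 0 ≤ ηz) {Nsq : V2 → ℝ}
    (hN1 : ∀ y, Nsq y ≤ ‖y‖ ^ 2)
    (h : ∀ y : V2, |⟪U x - T x, y⟫_ℝ| ≤ ηz * Real.sqrt (Nsq x) * Real.sqrt (Nsq y)) :
    ‖U x - T x‖ ≤ ηz * Real.sqrt (Nsq x) := by
  set y := U x - T x with hy
  have h1 := h y
  rw [real_inner_self_eq_norm_sq, abs_of_nonneg (sq_nonneg _)] at h1
  have hNy : Real.sqrt (Nsq y) ≤ ‖y‖ := by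
    rw [← Real.sqrt_sq (norm_nonneg y)]; exact Real.sqrt_le_sqrt (hN1 y)
  have h2 : ‖y‖ ^ 2 ≤ ηz * Real.sqrt (Nsq x) * ‖y‖ :=
    h1.trans (mul_le_mul_of_nonneg_left hNy (mul_nonneg hηz (Real.sqrt_nonneg _)))
  by_cases hy0 : ‖y‖ = 0
  · rw [hy0]; exact mul_nonneg hηz (Real.sqrt_nonneg _)
  · have hpos : 0 < ‖y‖ := lt_of_le_of_ne (norm_nonneg _) (Ne.symm hy0)
    nlinarith

set_option maxHeartbeats 1600000 in
/-- **§9d FROM §9z AND W3-E.**  The registered text of `stub_cellInputs_transfer` (= hypothesis `h9d` of `cellInputs_of_bilinear`, verbatim) from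
the bilinear window-error text §9z and the §4c W3-E text v31. -/
theorem cellInputs_transfer_of_bilinear_bandKill
    (hz :  ∀ k (W : Literature.Analysis.FluidPDE.LatticeShear.LatticeWord k) (M : ℝ) (hM : 0 < M) (c : ℝ), 0 < c →
    ∀ (Φ : ℝ → Torus.Visc4 (Fin 3) → Torus.Visc4 (Fin 3)) (lo hi Λ β σ C ν₀ K Cf νf Kf : ℝ),
      0 < lo → lo ≤ 1 → 1 ≤ hi → 1 < Λ → 0 ≤ β →
      0 < σ → 0 ≤ C → 0 < ν₀ → 0 < K → SlowVectorClauseF W M hM c Φ lo hi Λ β σ C ν₀ K →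
      0 ≤ Cf → 0 < νf → 0 < Kf → CellEnergyClausesW W M hM c lo hi Λ β Cf νf Kf →
      (∀ Kb : ℝ, 1 ≤ Kb → ∃ CK : ℝ, 1 ≤ CK ∧ ∃ cK > (0:ℝ), ∃ νh > (0:ℝ), HighLabelDecayW W M hM lo hi Λ β νh Kb CK cK) →
      ∃ ν₁ > (0:ℝ), ∃ K₁ > (0:ℝ), ∃ Λ₀ : ℕ, ∃ θ₀ > (0:ℝ), ∃ Cz > (0:ℝ), ∃ σz > (0:ℝ),
        ∀ E : Literature.Analysis.FluidPDE.LatticeShear.LagrangianLatticeCarrier k, E.design = W.stretch M hM → E.gain = c → E.nu0 ≤ ν₁ → K₁ ≤ E.K →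
          E.LPermissible → E.Regular → (∀ m, Λ₀ * E.N m ≤ E.N (m + 1)) → (∀ m, E.N m ^ 2 ≤ E.N (m + 1)) →
          (∀ m, E.cellVisc (m + 1) * ((E.N (m + 1) : ℝ) / E.N m) ^ (1 / 4 : ℝ) ≤ 1) →
          (∀ m, E.K * ((E.N (m + 1) : ℝ) / E.N m) ^ (1 / 4 : ℝ) ≤ ((E.N (m + 1) : ℝ) / E.N m) * E.cellVisc (m + 1)) →
          (∀ m, E.θ (m + 1) * ((E.N (m + 1) : ℝ) / E.N m) ^ (1 / 16 : ℝ) ≤ θ₀) →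
          (∀ m, ((E.N (m + 1) : ℝ) / E.N m) ^ (1 / 16 : ℝ) * E.physPeriod (m + 1) ≤ E.refresh (m + 1)) →
        ∃ mstar : ℕ, ∀ m, mstar ≤ m →
          ∀ Lc : ℕ, Lc = ⌊((E.N m : ℝ) / E.N (m + 1)) ^ (1 / 64 : ℝ) * (E.N (m + 1) * E.cellVisc (m + 1)) / Real.sqrt c⌋₊ →
          ∀ S : Torus.Visc4 (Fin 3), Torus.OddSmall S β → Torus.NearIso S lo hi →
            Torus.OddSmall (Φ (E.cellVisc (m + 1)) S) β → Torus.NearIso (Φ (E.cellVisc (m + 1)) S) lo hi →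
          ∀ Um Um1 : ℝ → ℝ → (V2 →L[ℝ] V2),
            Torus.IsPropagator 1 (E.partialSum m) (E.kbar m • renormStep (Φ (E.cellVisc (m + 1))) (E.gain / E.cellVisc (m + 1) ^ 2) S) Um →
            Torus.IsPropagator 1 (E.partialSum (m + 1)) (E.kbar (m + 1) • S) Um1 →
          ∀ ηz ε : ℝ, ηz = Cz * ((E.N m : ℝ) / E.N (m + 1)) ^ σz →
            ε = ((E.N m : ℝ) / E.N (m + 1)) ^ σz * (1 - Real.exp (-(4 * Real.pi ^ 2 * (E.kbar m * lo)))) * E.refresh (m + 1) →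
          ∀ S : Finset (Fin 3 → ℤ), S = (Torus.freqBall (Lc / 2)).erase 0 →
          ∀ (j : ℕ) (s' : ℝ), (j : ℝ) * E.refresh (m + 1) + E.refresh (m + 1) ≤ s' →
            s' ≤ (j : ℝ) * E.refresh (m + 1) + 2 * E.refresh (m + 1) → s' ≤ 1 →
            ∀ x y : V2,
              |⟪Um1 ((j : ℝ) * E.refresh (m + 1)) s' x - Um ((j : ℝ) * E.refresh (m + 1)) s' x, y⟫_ℝ| ≤ ηz
                * Real.sqrt (∑ k' ∈ S, min 1 ((E.a (m + 1) * (8 * Real.pi ^ 2 * ‖Torus.latticeVec k'‖ ^ 2 * lo * (E.cellVisc (m + 1) + c / E.cellVisc (m + 1)) / (E.N (m + 1) : ℝ) ^ 2)) * (s' - (j : ℝ) * E.refresh (m + 1))) * ‖UnitAddTorus.mFourierCoeff (EuclideanSpace.complexify ∘ ⇑(x)) k'‖ ^ 2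
                      + (‖x‖ ^ 2 - ∑ k' ∈ S, ‖UnitAddTorus.mFourierCoeff (EuclideanSpace.complexify ∘ ⇑(x)) k'‖ ^ 2))
                * Real.sqrt (∑ k' ∈ S, min 1 ((E.a (m + 1) * (8 * Real.pi ^ 2 * ‖Torus.latticeVec k'‖ ^ 2 * lo * (E.cellVisc (m + 1) + c / E.cellVisc (m + 1)) / (E.N (m + 1) : ℝ) ^ 2)) * (s' - (j : ℝ) * E.refresh (m + 1))) * ‖UnitAddTorus.mFourierCoeff (EuclideanSpace.complexify ∘ ⇑(y)) k'‖ ^ 2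
                      + (‖y‖ ^ 2 - ∑ k' ∈ S, ‖UnitAddTorus.mFourierCoeff (EuclideanSpace.complexify ∘ ⇑(y)) k'‖ ^ 2)))
    (hW3E : ∀ k (W : Literature.Analysis.FluidPDE.LatticeShear.LatticeWord k) (M : ℝ) (hM : 0 < M) (c : ℝ), 0 < c →
    ∀ (Φ : ℝ → Torus.Visc4 (Fin 3) → Torus.Visc4 (Fin 3)) (lo hi β : ℝ), 0 < lo → lo ≤ 1 → 1 ≤ hi → 0 ≤ β →
      ∃ C₂ : ℝ, 1 ≤ C₂ ∧ ∃ θ₁ > (0:ℝ), ∃ c₃ > (0:ℝ),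
        ∀ E : Literature.Analysis.FluidPDE.LatticeShear.LagrangianLatticeCarrier k, E.design = W.stretch M hM → E.gain = c →
          E.LPermissible → E.Regular → (∀ i, E.θ (i + 1) ≤ θ₁) → (∀ m, E.N m ^ 2 ≤ E.N (m + 1)) →
        ∀ (m : ℕ),
        ∀ (S : Torus.Visc4 (Fin 3)), Torus.OddSmall S β → Torus.NearIso S lo hi →
          Torus.OddSmall (Φ (E.cellVisc (m + 1)) S) β → Torus.NearIso (Φ (E.cellVisc (m + 1)) S) lo hi →
        ∀ Um : ℝ → ℝ → (V2 →L[ℝ] V2),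
          Torus.IsPropagator 1 (E.partialSum m) (E.kbar m • renormStep (Φ (E.cellVisc (m + 1))) (E.gain / E.cellVisc (m + 1) ^ 2) S) Um →
        ∀ (s s' : ℝ), 0 ≤ s → s ≤ s' → s' ≤ 1 → s' - s ≤ 2 * E.refresh (m + 1) →
        ∀ T : V2 →L[ℝ] V2, (T = Um s s' ∨ T = ContinuousLinearMap.adjoint (Um s s')) →
          -- (i) dissipation floor: the surviving energy loses at least half of the dissipation-weighted spectrum
          (∀ y : V2, ‖T y‖ ^ 2 ≤ ‖y‖ ^ 2 - 1 / 2 * ∑' k' : Fin 3 → ℤ,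
              min 1 (E.a (m + 1) * (8 * Real.pi ^ 2 * ‖Torus.latticeVec k'‖ ^ 2 * lo * (E.cellVisc (m + 1) + c / E.cellVisc (m + 1))
                / (E.N (m + 1) : ℝ) ^ 2) * (s' - s))
              * ‖UnitAddTorus.mFourierCoeff (EuclideanSpace.complexify ∘ ⇑y) k'‖ ^ 2) ∧
          -- (ii-out) band kill, output form (NORM form, factor gap), ENGINE-A currency: one factor-2 climb costs `e^(−c₃/θ(m+1))` (thin geometric
          -- bands, p4 21:08:07Z) and the additive-hop branch `e^(−(L−L')/(C₂ N_m))`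
          (∀ L' L : ℕ, 2 * L' ≤ L → ∀ y : V2,
              ‖T y - cutLp L (T y)‖
                ≤ Real.exp (-(E.a (m + 1) * (8 * Real.pi ^ 2 * (L' : ℝ) ^ 2 * lo * (E.cellVisc (m + 1) + c / E.cellVisc (m + 1))
                    / (E.N (m + 1) : ℝ) ^ 2) * (s' - s) / 2)) * ‖y - cutLp L' y‖
                  + (Real.exp (-(c₃ / E.θ (m + 1))) + Real.exp (-(((L : ℝ) - L') / (C₂ * E.N m)))) * ‖y‖) ∧
          -- (ii-in) band kill, input form (NORM form, factor gap), engine-A currency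
          (∀ L' L : ℕ, 2 * L' ≤ L → ∀ y : V2, cutLp L y = 0 →
              ‖T y‖
                ≤ (Real.exp (-(E.a (m + 1) * (8 * Real.pi ^ 2 * (L' : ℝ) ^ 2 * lo * (E.cellVisc (m + 1) + c / E.cellVisc (m + 1))
                    / (E.N (m + 1) : ℝ) ^ 2) * (s' - s) / 2))
                  + (Real.exp (-(c₃ / E.θ (m + 1))) + Real.exp (-(((L : ℝ) - L') / (C₂ * E.N m))))) * ‖y‖)) :
     ∀ k (W : Literature.Analysis.FluidPDE.LatticeShear.LatticeWord k) (M : ℝ) (hM : 0 < M) (c : ℝ), 0 < c →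
    ∀ (Φ : ℝ → Torus.Visc4 (Fin 3) → Torus.Visc4 (Fin 3)) (lo hi Λ β σ C ν₀ K Cf νf Kf : ℝ),
      0 < lo → lo ≤ 1 → 1 ≤ hi → 1 < Λ → 0 ≤ β →
      0 < σ → 0 ≤ C → 0 < ν₀ → 0 < K → SlowVectorClauseF W M hM c Φ lo hi Λ β σ C ν₀ K →
      0 ≤ Cf → 0 < νf → 0 < Kf → CellEnergyClausesW W M hM c lo hi Λ β Cf νf Kf →
      (∀ Kb : ℝ, 1 ≤ Kb → ∃ CK : ℝ, 1 ≤ CK ∧ ∃ cK > (0:ℝ), ∃ νh > (0:ℝ), HighLabelDecayW W M hM lo hi Λ β νh Kb CK cK) →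
      ∃ ν₁ > (0:ℝ), ∃ K₁ > (0:ℝ), ∃ Λ₀ : ℕ, ∃ θ₀ > (0:ℝ), ∃ Cz > (0:ℝ), ∃ σz > (0:ℝ),
        ∀ E : Literature.Analysis.FluidPDE.LatticeShear.LagrangianLatticeCarrier k, E.design = W.stretch M hM → E.gain = c → E.nu0 ≤ ν₁ → K₁ ≤ E.K →
          E.LPermissible → E.Regular → (∀ m, Λ₀ * E.N m ≤ E.N (m + 1)) → (∀ m, E.N m ^ 2 ≤ E.N (m + 1)) →
          (∀ m, E.cellVisc (m + 1) * ((E.N (m + 1) : ℝ) / E.N m) ^ (1 / 4 : ℝ) ≤ 1) →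
          (∀ m, E.K * ((E.N (m + 1) : ℝ) / E.N m) ^ (1 / 4 : ℝ) ≤ ((E.N (m + 1) : ℝ) / E.N m) * E.cellVisc (m + 1)) →
          (∀ m, E.θ (m + 1) * ((E.N (m + 1) : ℝ) / E.N m) ^ (1 / 16 : ℝ) ≤ θ₀) →
          (∀ m, ((E.N (m + 1) : ℝ) / E.N m) ^ (1 / 16 : ℝ) * E.physPeriod (m + 1) ≤ E.refresh (m + 1)) →
        ∃ mstar : ℕ, ∀ m, mstar ≤ m →
          ∀ Lc : ℕ, Lc = ⌊((E.N m : ℝ) / E.N (m + 1)) ^ (1 / 64 : ℝ) * (E.N (m + 1) * E.cellVisc (m + 1)) / Real.sqrt c⌋₊ →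
          ∀ S : Torus.Visc4 (Fin 3), Torus.OddSmall S β → Torus.NearIso S lo hi →
            Torus.OddSmall (Φ (E.cellVisc (m + 1)) S) β → Torus.NearIso (Φ (E.cellVisc (m + 1)) S) lo hi →
          ∀ Um Um1 : ℝ → ℝ → (V2 →L[ℝ] V2),
            Torus.IsPropagator 1 (E.partialSum m) (E.kbar m • renormStep (Φ (E.cellVisc (m + 1))) (E.gain / E.cellVisc (m + 1) ^ 2) S) Um →
            Torus.IsPropagator 1 (E.partialSum (m + 1)) (E.kbar (m + 1) • S) Um1 →
          ∀ ηz ε : ℝ, ηz = Cz * ((E.N m : ℝ) / E.N (m + 1)) ^ σz →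
            ε = ((E.N m : ℝ) / E.N (m + 1)) ^ σz * (1 - Real.exp (-(4 * Real.pi ^ 2 * (E.kbar m * lo)))) * E.refresh (m + 1) →
          ∀ A : Set (Fin 3 → ℤ), A = {k' : Fin 3 → ℤ | ∃ z : Fin 3 → ℤ, Torus.freqNormSq (k' - (E.N (m + 1) : ℤ) • z) ≤ (((Lc / 2 : ℕ) : ℝ)) ^ 2} →
          ∃ B C : Set (Fin 3 → ℤ),
            (∀ k', k' ∈ B ↔ -k' ∈ B) ∧ (∀ k', k' ∈ C ↔ -k' ∈ C) ∧
            (∀ k', k' ∈ A → k' ∉ B) ∧ (∀ k', k' ∈ A → k' ∉ C) ∧ (∀ k', k' ∈ B → k' ∉ C) ∧ (∀ k', k' ∈ A ∨ k' ∈ B ∨ k' ∈ C) ∧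
            (∀ k', k' ∈ C → ((Lc : ℝ)) ^ 2 < Torus.freqNormSq k') ∧
          ∀ P Q₁ Q₂ : V2 →L[ℝ] V2,
            (∀ (y : V2) (k' : Fin 3 → ℤ), UnitAddTorus.mFourierCoeff (EuclideanSpace.complexify ∘ ⇑(P y)) k' = if k' ∈ A then UnitAddTorus.mFourierCoeff (EuclideanSpace.complexify ∘ ⇑(y)) k' else 0) →
            (∀ (y : V2) (k' : Fin 3 → ℤ), UnitAddTorus.mFourierCoeff (EuclideanSpace.complexify ∘ ⇑(Q₁ y)) k' = if k' ∈ B then UnitAddTorus.mFourierCoeff (EuclideanSpace.complexify ∘ ⇑(y)) k' else 0) →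
            (∀ (y : V2) (k' : Fin 3 → ℤ), UnitAddTorus.mFourierCoeff (EuclideanSpace.complexify ∘ ⇑(Q₂ y)) k' = if k' ∈ C then UnitAddTorus.mFourierCoeff (EuclideanSpace.complexify ∘ ⇑(y)) k' else 0) →
          ∀ (w₁ : VF) (hw₁ : IsDatum w₁), Torus.fourierTruncate Lc w₁ = w₁ →
            ∀ (j : ℕ) (s' : ℝ), (j : ℝ) * E.refresh (m + 1) + E.refresh (m + 1) ≤ s' →
              s' ≤ (j : ℝ) * E.refresh (m + 1) + 2 * E.refresh (m + 1) → s' ≤ 1 →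
              ‖Q₁ (Um1 ((j : ℝ) * E.refresh (m + 1)) s' (P (Um1 0 ((j : ℝ) * E.refresh (m + 1)) (datumLp w₁ hw₁))))‖ ≤ Real.sqrt (ηz * (‖Um1 0 ((j : ℝ) * E.refresh (m + 1)) (datumLp w₁ hw₁)‖ ^ 2 - ‖Um ((j : ℝ) * E.refresh (m + 1)) s' (Um1 0 ((j : ℝ) * E.refresh (m + 1)) (datumLp w₁ hw₁))‖ ^ 2)) + ε * ‖datumLp w₁ hw₁‖ ∧
              ‖Q₂ (Um1 ((j : ℝ) * E.refresh (m + 1)) s' (P (Um1 0 ((j : ℝ) * E.refresh (m + 1)) (datumLp w₁ hw₁))))‖ ≤ Real.sqrt (ηz * (‖Um1 0 ((j : ℝ) * E.refresh (m + 1)) (datumLp w₁ hw₁)‖ ^ 2 - ‖Um ((j : ℝ) * E.refresh (m + 1)) s' (Um1 0 ((j : ℝ) * E.refresh (m + 1)) (datumLp w₁ hw₁))‖ ^ 2)) + ε * ‖datumLp w₁ hw₁‖ ∧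
              ‖Q₁ (Um1 ((j : ℝ) * E.refresh (m + 1)) s' (Q₁ (Um1 0 ((j : ℝ) * E.refresh (m + 1)) (datumLp w₁ hw₁))))‖ ≤ ηz * ‖Q₁ (Um1 0 ((j : ℝ) * E.refresh (m + 1)) (datumLp w₁ hw₁))‖ + ε * ‖datumLp w₁ hw₁‖ ∧
              ‖Q₂ (Um1 ((j : ℝ) * E.refresh (m + 1)) s' (Q₁ (Um1 0 ((j : ℝ) * E.refresh (m + 1)) (datumLp w₁ hw₁))))‖ ≤ ηz * ‖Q₁ (Um1 0 ((j : ℝ) * E.refresh (m + 1)) (datumLp w₁ hw₁))‖ + ε * ‖datumLp w₁ hw₁‖ ∧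
              ‖Q₁ (Um1 ((j : ℝ) * E.refresh (m + 1)) s' (Q₂ (Um1 0 ((j : ℝ) * E.refresh (m + 1)) (datumLp w₁ hw₁))))‖ ≤ ηz * ‖Q₂ (Um1 0 ((j : ℝ) * E.refresh (m + 1)) (datumLp w₁ hw₁))‖ + ε * ‖datumLp w₁ hw₁‖ ∧
              ‖Q₂ (Um1 ((j : ℝ) * E.refresh (m + 1)) s' (Q₂ (Um1 0 ((j : ℝ) * E.refresh (m + 1)) (datumLp w₁ hw₁))))‖ ≤ 1 / 2 * ‖Q₂ (Um1 0 ((j : ℝ) * E.refresh (m + 1)) (datumLp w₁ hw₁))‖ + ε * ‖datumLp w₁ hw₁‖ := by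
  intro k W M hM c hc Φ lo hi Λ β σ C ν₀ K Cf νf Kf hlo hlo1 hhi hΛ hβ hσ hC hν₀ hK hV hCf hνf hKf hF hH
  obtain ⟨C₂, hC₂, θ₁, hθ₁, c₃, hc₃, hW⟩ := hW3E k W M hM c hc Φ lo hi β hlo hlo1 hhi hβ
  obtain ⟨ν₁, hν₁, K₁, hK₁, Λ₀, θ₀, hθ₀, Cz, hCz, σz, hσz, hbil⟩ :=
    hz k W M hM c hc Φ lo hi Λ β σ C ν₀ K Cf νf Kf hlo hlo1 hhi hΛ hβ hσ hC hν₀ hK hV hCf hνf hKf hF hH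
  refine ⟨ν₁, hν₁, K₁, hK₁, Λ₀, min θ₀ θ₁, lt_min hθ₀ hθ₁, 2 * Cz ^ 2 + Cz, by positivity, σz, hσz, ?_⟩
  intro E hdes hgain hnu0 hKE hLP hReg hT1 hN2 hT2 hT3 hT4' hT5
  have hP : E.toFractalCarrierData.Permissible := hLP.1
  have hT4 : ∀ m, E.θ (m + 1) * ((E.N (m + 1) : ℝ) / E.N m) ^ (1 / 16 : ℝ) ≤ θ₀ := fun m => (hT4' m).trans (min_le_left _ _)
  have hθall : ∀ i, E.θ (i + 1) ≤ θ₁ := by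
    intro i
    have h1 := (hT4' i).trans (min_le_right _ _)
    have hs1 := one_le_sep16 E.toFractalCarrierData hP i
    have hθp := E.θ_pos (i + 1)
    nlinarith
  obtain ⟨m₁, hm₁⟩ := hbil E hdes hgain hnu0 hKE hLP hReg hT1 hN2 hT2 hT3 hT4 hT5
  obtain ⟨m₂, hm₂⟩ := hi_tails_le_eps E hdes hLP hN2 hT2 hT3 hθ₀ hT4 hT5 σz hlo hc hC₂ hc₃
  obtain ⟨m₄, hm₄⟩ := off_ball_rate_ge_one E hdes hLP hN2 hT3 hT5 hlo hc
  obtain ⟨m₅, hm₅⟩ := exists_forall_mul_rho_rpow_le E.toFractalCarrierData hP hN2 Cz hσz (ε := 1 / 2) (by norm_num)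
  refine ⟨max (max m₁ m₂) (max m₄ m₅), fun m hm => ?_⟩
  have hm1 : m₁ ≤ m := le_trans ((le_max_left _ _).trans (le_max_left _ _)) hm
  have hm2 : m₂ ≤ m := le_trans ((le_max_right _ _).trans (le_max_left _ _)) hm
  have hm4 : m₄ ≤ m := le_trans ((le_max_left _ _).trans (le_max_right _ _)) hm
  have hm5 : m₅ ≤ m := le_trans ((le_max_right _ _).trans (le_max_right _ _)) hm
  intro Lc hLc S hS₁ hS₂ hS₃ hS₄ Um Um1 hUm hUm1 ηz ε hηz hε A hA
  have hρ0 : 0 < (E.N m : ℝ) / E.N (m + 1) := div_pos (by exact_mod_cast E.N_pos m) (by exact_mod_cast E.N_pos (m + 1))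
  have hρ1 : (E.N m : ℝ) / E.N (m + 1) ≤ 1 := by
    rw [div_le_one (by exact_mod_cast E.N_pos (m + 1))]
    have h2 := two_le_ratio E.toFractalCarrierData hP m
    have hNm : (0 : ℝ) < E.N m := by exact_mod_cast E.N_pos m
    rw [le_div_iff₀ hNm] at h2; linarith
  have hρσ : 0 < ((E.N m : ℝ) / E.N (m + 1)) ^ σz := Real.rpow_pos_of_pos hρ0 _
  have hρσ1 : ((E.N m : ℝ) / E.N (m + 1)) ^ σz ≤ 1 := Real.rpow_le_one hρ0.le hρ1 hσz.le
  set η₀ : ℝ := Cz * ((E.N m : ℝ) / E.N (m + 1)) ^ σz with hη₀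
  have hη₀0 : 0 < η₀ := mul_pos hCz hρσ
  have hη₀le : η₀ ≤ ηz := by
    rw [hηz, hη₀]; have := hCz.le; nlinarith [sq_nonneg Cz, mul_nonneg (sq_nonneg Cz) hρσ.le]
  have hη₀sq : 2 * η₀ ^ 2 ≤ ηz := by
    rw [hηz, hη₀]
    have h1 : (((E.N m : ℝ) / E.N (m + 1)) ^ σz) ^ 2 ≤ ((E.N m : ℝ) / E.N (m + 1)) ^ σz := by nlinarith
    nlinarith [mul_nonneg hCz.le hρσ.le, sq_nonneg Cz]
  have hη₀half : η₀ ≤ 1 / 2 := hm₅ m hm5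
  have hr : 0 < E.refresh (m + 1) := E.refresh_pos (m + 1)
  have hkl : 0 ≤ 4 * Real.pi ^ 2 * (E.kbar m * lo) := by have := E.kbar_pos m; positivity
  have hε0 : 0 ≤ ε := by
    rw [hε]
    refine mul_nonneg (mul_nonneg hρσ.le ?_) hr.le
    rw [sub_nonneg]; exact Real.exp_le_one_iff.2 (by linarith)
  have hbw := hm₁ m hm1 Lc hLc S hS₁ hS₂ hS₃ hS₄ Um Um1 hUm hUm1 η₀ ε rfl hε ((Torus.freqBall (Lc / 2)).erase 0) rfl
  have hAsym : ∀ k', k' ∈ A ↔ -k' ∈ A := by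
    intro k'
    rw [hA]
    simp only [Set.mem_setOf_eq]
    constructor
    · rintro ⟨z, hz'⟩; refine ⟨-z, ?_⟩
      rw [show -k' - (E.N (m + 1) : ℤ) • (-z) = -(k' - (E.N (m + 1) : ℤ) • z) by simp [smul_neg]; abel,
        Torus.freqNormSq_neg]; exact hz'
    · rintro ⟨z, hz'⟩; refine ⟨-z, ?_⟩
      rw [show k' - (E.N (m + 1) : ℤ) • (-z) = -(-k' - (E.N (m + 1) : ℤ) • z) by simp [smul_neg]; abel,
        Torus.freqNormSq_neg]; exact hz'
  have hAball : ∀ k', k' ∉ A → (((Lc / 2 : ℕ) : ℝ)) ^ 2 < Torus.freqNormSq k' := by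
    intro k' hk'
    by_contra hle
    apply hk'
    rw [hA]; exact ⟨0, by simpa using not_lt.mp hle⟩
  set B : Set (Fin 3 → ℤ) := {k' | k' ∉ A ∧ Torus.freqNormSq k' ≤ ((Lc : ℝ)) ^ 2} with hB
  set Cset : Set (Fin 3 → ℤ) := {k' | k' ∉ A ∧ ((Lc : ℝ)) ^ 2 < Torus.freqNormSq k'} with hCset
  have hBsym : ∀ k', k' ∈ B ↔ -k' ∈ B := fun k' => by
    simp only [hB, Set.mem_setOf_eq, Torus.freqNormSq_neg, ← hAsym k']
  have hCsym : ∀ k', k' ∈ Cset ↔ -k' ∈ Cset := fun k' => by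
    simp only [hCset, Set.mem_setOf_eq, Torus.freqNormSq_neg, ← hAsym k']
  have hAB : ∀ k', k' ∈ A → k' ∉ B := fun k' hk hb => hb.1 hk
  have hAC : ∀ k', k' ∈ A → k' ∉ Cset := fun k' hk hcm => hcm.1 hk
  have hBC : ∀ k', k' ∈ B → k' ∉ Cset := fun k' hb hcm => absurd hcm.2 (not_lt.mpr hb.2)
  have hcov : ∀ k', k' ∈ A ∨ k' ∈ B ∨ k' ∈ Cset := by
    intro k'
    by_cases hk : k' ∈ A
    · exact Or.inl hk
    · by_cases hle : Torus.freqNormSq k' ≤ ((Lc : ℝ)) ^ 2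
      · exact Or.inr (Or.inl ⟨hk, hle⟩)
      · exact Or.inr (Or.inr ⟨hk, not_le.mp hle⟩)
  have hCf : ∀ k', k' ∈ Cset → ((Lc : ℝ)) ^ 2 < Torus.freqNormSq k' := fun k' hk => hk.2
  have hBf : ∀ k' ∈ B, (((Lc / 2 : ℕ) : ℝ)) ^ 2 < Torus.freqNormSq k' := fun k' hk => hAball k' hk.1
  have hCf2 : ∀ k' ∈ Cset, (((Lc / 2 : ℕ) : ℝ)) ^ 2 < Torus.freqNormSq k' := fun k' hk => hAball k' hk.1
  refine ⟨B, Cset, hBsym, hCsym, hAB, hAC, hBC, hcov, hCf, ?_⟩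
  intro P Q₁ Q₂ hPc hQ₁c hQ₂c w₁ hw₁ hband j s' h1 h2 h3
  have hs0 : 0 ≤ (j : ℝ) * E.refresh (m + 1) := by positivity
  have hss' : (j : ℝ) * E.refresh (m + 1) ≤ s' := by linarith
  have hlen : s' - (j : ℝ) * E.refresh (m + 1) ≤ 2 * E.refresh (m + 1) := by linarith
  have hτr : E.refresh (m + 1) ≤ s' - (j : ℝ) * E.refresh (m + 1) := by linarith
  have hτ : 0 < s' - (j : ℝ) * E.refresh (m + 1) := by linarith
  set x₁ : V2 := datumLp w₁ hw₁ with hx₁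
  set u : V2 := Um1 0 ((j : ℝ) * E.refresh (m + 1)) x₁ with hu
  set T : V2 →L[ℝ] V2 := Um ((j : ℝ) * E.refresh (m + 1)) s' with hTdef
  set U : V2 →L[ℝ] V2 := Um1 ((j : ℝ) * E.refresh (m + 1)) s' with hUdef
  set rate : (Fin 3 → ℤ) → ℝ := fun k' => E.a (m + 1) * (8 * Real.pi ^ 2 * ‖Torus.latticeVec k'‖ ^ 2 * lo
      * (E.cellVisc (m + 1) + c / E.cellVisc (m + 1)) / (E.N (m + 1) : ℝ) ^ 2) with hrate
  set w : (Fin 3 → ℤ) → ℝ := fun k' => min 1 (rate k' * (s' - (j : ℝ) * E.refresh (m + 1))) with hwdef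
  set SB : Finset (Fin 3 → ℤ) := (Torus.freqBall (Lc / 2)).erase 0 with hSB
  set Nsq : V2 → ℝ := fun x => ∑ k' ∈ SB, w k' * ‖mFourierCoeff (EuclideanSpace.complexify ∘ ⇑x) k'‖ ^ 2
      + (‖x‖ ^ 2 - ∑ k' ∈ SB, ‖mFourierCoeff (EuclideanSpace.complexify ∘ ⇑x) k'‖ ^ 2) with hNsq
  have hrate0 : ∀ k', 0 ≤ rate k' := fun k' => by
    have := E.a_pos (m + 1); have := cellVisc_pos' E.toFractalCarrierData (m + 1); rw [hrate]; positivity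
  have hw0 : ∀ k', 0 ≤ w k' := fun k' => le_min zero_le_one (mul_nonneg (hrate0 k') hτ.le)
  have hw1 : ∀ k', w k' ≤ 1 := fun k' => min_le_left _ _
  have hoff := hm₄ m hm4 (s' - (j : ℝ) * E.refresh (m + 1)) hτr Lc hLc
  have hwoff : ∀ k', k' ∉ Torus.freqBall (Lc / 2) → w k' = 1 := fun k' hk' =>
    min_eq_left (by have := hoff k' hk'; rw [hrate]; exact this)
  have hN1 : ∀ x : V2, Nsq x ≤ ‖x‖ ^ 2 := fun x => weightedNormSq_le_norm_sq SB w hw1 x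
  have hNle : ∀ x : V2, Real.sqrt (Nsq x) ≤ ‖x‖ := fun x => by
    rw [← Real.sqrt_sq (norm_nonneg x)]; exact Real.sqrt_le_sqrt (hN1 x)
  have hux : ‖u‖ ≤ ‖x₁‖ := hUm1.norm_le 0 _ x₁
  have hPu : ‖P u‖ ≤ ‖u‖ := norm_proj_le hPc u
  have hQ₁u : ‖Q₁ u‖ ≤ ‖u‖ := norm_proj_le hQ₁c u
  have hQ₂u : ‖Q₂ u‖ ≤ ‖u‖ := norm_proj_le hQ₂c u
  have hQ₁n : ∀ z, ‖Q₁ z‖ ≤ ‖z‖ := norm_proj_le hQ₁c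
  have hQ₂n : ∀ z, ‖Q₂ z‖ ≤ ‖z‖ := norm_proj_le hQ₂c
  have hTc : ∀ y, ‖T y‖ ≤ ‖y‖ := fun y => hUm.norm_le _ _ y
  have hstrong : ∀ x : V2, ‖U x - T x‖ ≤ η₀ * Real.sqrt (Nsq x) := fun x =>
    norm_sub_le_of_bilinear_strong hη₀0.le hN1 fun y => hbw j s' h1 h2 h3 x y
  obtain ⟨hiT, hoT, hnT⟩ := hW E hdes hgain hLP hReg hθall hN2 m S hS₁ hS₂ hS₃ hS₄ Um hUm ((j : ℝ) * E.refresh (m + 1)) s' hs0 hss'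
    h3 hlen T (Or.inl rfl)
  obtain ⟨-, -, hnA⟩ := hW E hdes hgain hLP hReg hθall hN2 m S hS₁ hS₂ hS₃ hS₄ Um hUm ((j : ℝ) * E.refresh (m + 1)) s' hs0 hss'
    h3 hlen (adjoint T) (Or.inr rfl)
  have hgap : 2 * (Lc / 2 / 2) ≤ Lc / 2 := Nat.mul_div_le (Lc / 2) 2
  have hεt := hm₂ m hm2 (s' - (j : ℝ) * E.refresh (m + 1)) hτr Lc (Lc / 2) (Lc / 2 / 2) hLc rfl rfl
  rw [← hε] at hεt
  have hHi1 : ∀ y : V2, ‖Q₁ (T y)‖ ≤ ε * ‖y‖ := fun y => by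
    have h := (hi_of_bandKill (L' := Lc / 2 / 2) (L := Lc / 2) hBf hQ₁c T (Real.exp_nonneg _)
      (add_nonneg (Real.exp_nonneg _) (Real.exp_nonneg _)) (hoT (Lc / 2 / 2) (Lc / 2) hgap) (hnT (Lc / 2 / 2) (Lc / 2) hgap)
      (hnA (Lc / 2 / 2) (Lc / 2) hgap) y).2.1
    exact h.trans (mul_le_mul_of_nonneg_right hεt (norm_nonneg y))
  have hHi2 : ∀ y : V2, ‖Q₂ (T y)‖ ≤ ε * ‖y‖ := fun y => by
    have h := (hi_of_bandKill (L' := Lc / 2 / 2) (L := Lc / 2) hCf2 hQ₂c T (Real.exp_nonneg _)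
      (add_nonneg (Real.exp_nonneg _) (Real.exp_nonneg _)) (hoT (Lc / 2 / 2) (Lc / 2) hgap) (hnT (Lc / 2 / 2) (Lc / 2) hgap)
      (hnA (Lc / 2 / 2) (Lc / 2) hgap) y).2.1
    exact h.trans (mul_le_mul_of_nonneg_right hεt (norm_nonneg y))
  have hklo1 : 0 < E.kbar (m + 1) * lo := mul_pos (E.kbar_pos (m + 1)) hlo
  have h𝔸1 : Torus.NearIso (E.kbar (m + 1) • S) (E.kbar (m + 1) * lo) (E.kbar (m + 1) * hi) := hS₂.smul (E.kbar_pos (m + 1)).le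
  have hx_div : Torus.IsWeaklyDivFree ((x₁ : V2) : VF) := isWeaklyDivFree_datumLp w₁ hw₁
  have hs1 : (j : ℝ) * E.refresh (m + 1) ≤ 1 := hss'.trans h3
  have hu0 : mFourierCoeff (EuclideanSpace.complexify ∘ ⇑u) 0 = 0 := by
    rw [hu, fcoeff_zero_apply_eq E hReg (m + 1) hklo1 h𝔸1 hUm1 le_rfl hs0 hs1 x₁ hx_div]
    exact fcoeff_zero_datumLp w₁ hw₁
  have hy₀ : ∀ k', mFourierCoeff (EuclideanSpace.complexify ∘ ⇑u) k'
      = if k' = 0 then 0 else mFourierCoeff (EuclideanSpace.complexify ∘ ⇑u) k' := fun k' => by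
    split_ifs with hk
    · rw [hk]; exact hu0
    · rfl
  have hfloor : Nsq u ≤ 2 * (‖u‖ ^ 2 - ‖T u‖ ^ 2) := by
    have h := floor_meanfree (Lc / 2) T u u w hw0 hwoff hy₀ (hiT u)
    rw [hNsq]; linarith
  have hNP : Nsq (P u) ≤ Nsq u := weightedNormSq_proj_le SB w hw0 hPc u
  have hq0 : 0 ≤ ‖u‖ ^ 2 - ‖T u‖ ^ 2 := by have := hTc u; nlinarith [norm_nonneg (T u)]
  have hlow : ∀ (Q : V2 →L[ℝ] V2), (∀ z, ‖Q z‖ ≤ ‖z‖) → (∀ y, ‖Q (T y)‖ ≤ ε * ‖y‖) →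
      ‖Q (U (P u))‖ ≤ Real.sqrt (ηz * (‖u‖ ^ 2 - ‖T u‖ ^ 2)) + ε * ‖x₁‖ := by
    intro Q hQ hQHi
    have e : U (P u) = T (P u) + (U (P u) - T (P u)) := by abel
    have h1 : ‖Q (U (P u))‖ ≤ ε * ‖P u‖ + η₀ * Real.sqrt (Nsq (P u)) := by
      rw [e, map_add]
      exact (norm_add_le _ _).trans (add_le_add (hQHi _) ((hQ _).trans (hstrong _)))
    have h2 : Real.sqrt (Nsq (P u)) ≤ Real.sqrt (2 * (‖u‖ ^ 2 - ‖T u‖ ^ 2)) := Real.sqrt_le_sqrt (hNP.trans hfloor)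
    have h3 : η₀ * Real.sqrt (2 * (‖u‖ ^ 2 - ‖T u‖ ^ 2)) ≤ Real.sqrt (ηz * (‖u‖ ^ 2 - ‖T u‖ ^ 2)) := by
      rw [show η₀ * Real.sqrt (2 * (‖u‖ ^ 2 - ‖T u‖ ^ 2)) = Real.sqrt ((2 * η₀ ^ 2) * (‖u‖ ^ 2 - ‖T u‖ ^ 2)) by
        rw [show (2 * η₀ ^ 2) * (‖u‖ ^ 2 - ‖T u‖ ^ 2) = η₀ ^ 2 * (2 * (‖u‖ ^ 2 - ‖T u‖ ^ 2)) by ring,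
          Real.sqrt_mul (sq_nonneg _), Real.sqrt_sq hη₀0.le]]
      exact Real.sqrt_le_sqrt (mul_le_mul_of_nonneg_right hη₀sq hq0)
    calc ‖Q (U (P u))‖ ≤ ε * ‖P u‖ + η₀ * Real.sqrt (Nsq (P u)) := h1
      _ ≤ ε * ‖x₁‖ + η₀ * Real.sqrt (2 * (‖u‖ ^ 2 - ‖T u‖ ^ 2)) :=
          add_le_add (mul_le_mul_of_nonneg_left (hPu.trans hux) hε0) (mul_le_mul_of_nonneg_left h2 hη₀0.le)
      _ ≤ ε * ‖x₁‖ + Real.sqrt (ηz * (‖u‖ ^ 2 - ‖T u‖ ^ 2)) := add_le_add le_rfl h3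
      _ = Real.sqrt (ηz * (‖u‖ ^ 2 - ‖T u‖ ^ 2)) + ε * ‖x₁‖ := add_comm _ _
  have hhigh : ∀ (Q : V2 →L[ℝ] V2), (∀ z, ‖Q z‖ ≤ ‖z‖) → (∀ y, ‖Q (T y)‖ ≤ ε * ‖y‖) → ∀ (y : V2), ‖y‖ ≤ ‖x₁‖ →
      ‖Q (U y)‖ ≤ η₀ * ‖y‖ + ε * ‖x₁‖ := by
    intro Q hQ hQHi y hyx
    have h := Transfer.norm_high_transfer_le (U := ⇑U) (T := ⇑T) (Q := ⇑Q) (N := fun x => Real.sqrt (Nsq x)) hη₀0.le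
      (fun a b => map_add Q a b) hQ hQHi hstrong hNle y
    exact h.trans (Transfer.high_transfer_currency hε0 (norm_nonneg y) hyx le_rfl)
  have hR3 := hhigh Q₁ hQ₁n hHi1 (Q₁ u) (hQ₁u.trans hux)
  have hR4 := hhigh Q₂ hQ₂n hHi2 (Q₁ u) (hQ₁u.trans hux)
  have hR5 := hhigh Q₁ hQ₁n hHi1 (Q₂ u) (hQ₂u.trans hux)
  have hR6 := hhigh Q₂ hQ₂n hHi2 (Q₂ u) (hQ₂u.trans hux)
  have hQ₁u0 := norm_nonneg (Q₁ u)
  have hQ₂u0 := norm_nonneg (Q₂ u)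
  exact ⟨hlow Q₁ hQ₁n hHi1, hlow Q₂ hQ₂n hHi2,
    hR3.trans (add_le_add (mul_le_mul_of_nonneg_right hη₀le hQ₁u0) le_rfl),
    hR4.trans (add_le_add (mul_le_mul_of_nonneg_right hη₀le hQ₁u0) le_rfl),
    hR5.trans (add_le_add (mul_le_mul_of_nonneg_right hη₀le hQ₂u0) le_rfl),
    hR6.trans (add_le_add (mul_le_mul_of_nonneg_right hη₀half hQ₂u0) le_rfl)⟩

end Summit.AnomalousDissipation.AnomalousDissipation.Theorems.SolenoidalFractalHomogenisation.LagrangianStep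

end
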